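import Summits.CriticalPhenomena.PercolationContinuityZ3.Theorems.PercNearOneGluingNoHeavyLowerTailKNQuestion9ContractLaw
import Summits.CriticalPhenomena.PercolationContinuityZ3.Theorems.PercNearOneGluingNoHeavyLowerTailIncStarCutVertex
import Literature.Probability.LatticeModels.ProdBernoulliClusterLocality
import Literature.Probability.Percolation.ShorteningInfluenceBound
import Literature.Probability.Percolation.KozmaNitzanPinning
import Summits.CriticalPhenomena.PercolationContinuityZ3.Theorems.PercNearOneGluingNoHeavyLowerTailCubicThreePointGluingMeasure
import HarnessLib

/-!
# Two-terminal blob reduction, I: one contraction step (weights and probabilities)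

Support file for the Sahi programme (`--supports stmt-CriticalPhenomena-4575`, prover prim-sahi-p2 gen 11).  No definitions,
no named facts, no sorries; standard axioms.  Memo `…/prim-sahi-p2/PROOF-E3.md` §22.

A *two-terminal blob* of a weight `W : Sym2 V → [0,1]` is a finite set `B` of INTERIOR vertices with terminals `u ≠ v`
outside `B` such that every pair joining `B` to a vertex outside `B ∪ {u,v}` has weight `0`.  The blob pairs are the pairs
meeting `B` together with the terminal pair `s(u,v)`.  Part II (`…SahiBlobReduction`) proves that replacing the whole blob by
the single pair `s(u,v)` carrying the blob's two-terminal connection probability preserves every joint moment of the principal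
cluster events `{C_s ⊇ T}` with `s, T` outside `B` — by induction on the blob, one pair at a time (one-bond decomposition
+ the tree's weight-one contraction `KnQ9Contract`).  This file supplies the weight identities of one contraction step:
for a blob pair `e = s(x,z)` (`x ∈ B`, `z ∈ B ∪ {u,v}`, `z ≠ x`) and `W₁ = W[e ↦ 1]`, the contracted weight
`cweight z x W₁` (vertex `x` merged into `z`) is again a blob weight for `(B,u,v)` (`cweight_blob`), agrees with `W` off the
blob pairs (`cweight_off_blob`), has strictly fewer active interior vertices (`cweight_active`), and "restriction to the blob
pairs" commutes with the contraction (`blobRestrict_cweight`); and the probabilistic one-step identities: one-bond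
decomposition (`oneBond`), loops are irrelevant (`real_update_diag`), the open branch is the contraction for principal
events (`real_principal_contract`) and for the blob's two-terminal probability (`blob_real_openConn_step`), and the base
case of a blob reduced to the single pair `s(u,v)` (`real_openConn_of_single`).
-/

noncomputable section

namespace Summit.CriticalPhenomena.PercolationContinuityZ3.Theorems

namespace SahiBlobReduction

open Finset Set unitInterval Literature.Probability.Percolation Literature.Probability.LatticeModels KnQ9Contract
open scoped Classical

variable {V : Type*}

/-- A pair containing `x` is `s(x, z)` for some `z`. [folklore] -/
theorem exists_eq_mk_of_mem {x : V} {e : Sym2 V} (h : x ∈ e) : ∃ z, e = s(x, z) := by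
  induction e using Sym2.ind with
  | h a b =>
    rcases Sym2.mem_iff.1 h with rfl | rfl
    · exact ⟨b, rfl⟩
    · exact ⟨a, Sym2.eq_swap⟩

section Step

variable {B : Finset V} {u v x z : V} (W : Sym2 V → unitInterval)
  (hu : u ∉ B) (hv : v ∉ B) (hx : x ∈ B) (hz : z ∈ B ∨ z = u ∨ z = v) (hzx : z ≠ x)
  (hW : ∀ x' ∈ B, ∀ z', z' ∉ B → z' ≠ u → z' ≠ v → W s(x', z') = 0)

/-- A pair meeting `B` is not the terminal pair. [folklore] -/
theorem mk_ne_terminal (hu : u ∉ B) (hv : v ∉ B) {x' : V} (hx' : x' ∈ B) (z' : V) : s(x', z') ≠ s(u, v) := by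
  intro h
  rcases Sym2.eq_iff.1 h with ⟨h1, _⟩ | ⟨h1, _⟩
  · exact hu (h1 ▸ hx')
  · exact hv (h1 ▸ hx')

/-- `W[e ↦ c]` agrees with `W` on every pair avoiding `x` (`e = s(x,z)`). [folklore] -/
theorem update_of_not_mem (c : unitInterval) {e' : Sym2 V} (he' : x ∉ e') :
    Function.update W s(x, z) c e' = W e' :=
  Function.update_of_ne (show e' ≠ s(x, z) from fun h => he' (h ▸ Sym2.mem_mk_left x z)) _ _

include hzx in
/-- `W[s(x,z) ↦ c]` at `s(y, z)` for `y ≠ x`. [folklore] -/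
theorem update_mk_z {y : V} (hyx : y ≠ x) (c : unitInterval) :
    Function.update W s(x, z) c s(y, z) = W s(y, z) := by
  refine Function.update_of_ne (fun h => ?_) _ _
  rcases Sym2.eq_iff.1 h with ⟨h1, _⟩ | ⟨_, h2⟩
  · exact hyx h1
  · exact hzx h2

include hzx in
/-- `W[s(x,z) ↦ c]` at `s(y, x)` for `y ≠ z`. [folklore] -/
theorem update_mk_x {y : V} (hyz : y ≠ z) (c : unitInterval) :
    Function.update W s(x, z) c s(y, x) = W s(y, x) := by
  refine Function.update_of_ne (fun h => ?_) _ _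
  rcases Sym2.eq_iff.1 h with ⟨_, h2⟩ | ⟨h1, _⟩
  · exact hzx h2.symm
  · exact hyz h1

include hx hz hzx hW in
/-- **The contracted weight is again a blob weight for `(B, u, v)`.** [this work] -/
theorem cweight_blob (x' : V) (hx' : x' ∈ B) (z' : V) (hz'B : z' ∉ B) (hz'u : z' ≠ u) (hz'v : z' ≠ v) :
    cweight z x (Function.update W s(x, z) 1) s(x', z') = 0 := by
  by_cases hx'x : x' = x
  · subst hx'x; exact cweight_of_mem _ (Sym2.mem_mk_left _ _)
  have hz'x : z' ≠ x := fun h => hz'B (h ▸ hx)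
  have hz'z : z' ≠ z := by
    rintro rfl
    rcases hz with h | h | h
    · exact hz'B h
    · exact hz'u h
    · exact hz'v h
  by_cases hx'z : x' = z
  · subst hx'z
    -- the parallel pair `s(z', x')` read at the kept vertex: `W s(z',x') ⊕ W s(z',x) = 0 ⊕ 0`
    rw [show s(x', z') = s(z', x') from Sym2.eq_swap]
    apply Subtype.ext
    rw [coe_cweight_parallel hzx _ hz'z hz'x, update_mk_z W hzx hz'x, update_mk_x W hzx hz'z,
      show s(z', x') = s(x', z') from Sym2.eq_swap, hW x' hx' z' hz'B hz'u hz'v,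
      show s(z', x) = s(x, z') from Sym2.eq_swap, hW x hx z' hz'B hz'u hz'v]
    simp
  · rw [cweight_of_not _ hx'x hz'x (fun h => hx'z h.1) (fun h => hz'z h.1),
      update_of_not_mem W 1 (fun h => ?_), hW x' hx' z' hz'B hz'u hz'v]
    rcases Sym2.mem_iff.1 h with h | h
    · exact hx'x h.symm
    · exact hz'x h.symm

include hu hv hx hz hzx hW in
/-- **Off the blob pairs the contracted weight is `W`.** [this work] -/
theorem cweight_off_blob (e' : Sym2 V) (he'B : ∀ x' ∈ B, x' ∉ e') (he'uv : e' ≠ s(u, v)) :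
    cweight z x (Function.update W s(x, z) 1) e' = W e' := by
  have hxe' : x ∉ e' := he'B x hx
  revert he'B he'uv hxe'
  induction e' using Sym2.ind with
  | h a b =>
    intro he'B he'uv hxe'
    have hax : a ≠ x := fun h => hxe' (h ▸ Sym2.mem_mk_left a b)
    have hbx : b ≠ x := fun h => hxe' (h ▸ Sym2.mem_mk_right a b)
    have haB : a ∉ B := fun h => he'B a h (Sym2.mem_mk_left a b)
    have hbB : b ∉ B := fun h => he'B b h (Sym2.mem_mk_right a b)
    -- the parallel case: `a = z` (then `z ∈ {u,v}`), `b ∉ B ∪ {u, v}`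
    have hpar : ∀ a b : V, a ∉ B → b ∉ B → s(a, b) ≠ s(u, v) → a ≠ x → b ≠ x → a = z → b ≠ z →
        cweight z x (Function.update W s(x, z) 1) s(a, b) = W s(a, b) := by
      intro a b haB hbB hne hax hbx haz hbz
      subst haz
      have hbu : b ≠ u := by
        rintro rfl
        rcases hz with h | h | h
        · exact haB h
        · exact hbz h.symm
        · exact hne (h ▸ Sym2.eq_swap)
      have hbv : b ≠ v := by
        rintro rfl
        rcases hz with h | h | h
        · exact haB h
        · exact hne (h ▸ rfl)
        · exact hbz h.symm
      rw [show s(a, b) = s(b, a) from Sym2.eq_swap]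
      apply Subtype.ext
      rw [coe_cweight_parallel hzx _ hbz hbx, update_mk_z W hzx hbx, update_mk_x W hzx hbz,
        show s(b, x) = s(x, b) from Sym2.eq_swap, hW x hx b hbB hbu hbv]
      simp
    by_cases h1 : a = z ∧ b ≠ z
    · exact hpar a b haB hbB he'uv hax hbx h1.1 h1.2
    by_cases h2 : b = z ∧ a ≠ z
    · rw [show s(a, b) = s(b, a) from Sym2.eq_swap] at he'uv ⊢
      exact hpar b a hbB haB he'uv hbx hax h2.1 h2.2
    rw [cweight_of_not _ hax hbx h1 h2, update_of_not_mem W 1 hxe']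

include hzx in
/-- **Active interior vertices of the contracted weight**: every `y ∈ B` carrying a non-zero contracted pair is not `x`
and already carries a non-zero pair of `W`. [this work] -/
theorem cweight_active {y : V} (z' : V) (h : cweight z x (Function.update W s(x, z) 1) s(y, z') ≠ 0)
    (he : W s(x, z) ≠ 0) : y ≠ x ∧ ∃ z'', W s(y, z'') ≠ 0 := by
  have hyx : y ≠ x := by
    rintro rfl; exact h (cweight_of_mem _ (Sym2.mem_mk_left _ _))
  have hz'x : z' ≠ x := by
    rintro rfl; exact h (cweight_of_mem _ (Sym2.mem_mk_right _ _))
  refine ⟨hyx, ?_⟩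
  by_cases h1 : y = z ∧ z' ≠ z
  · -- `y = z`: the pair `e = s(x,z)` itself is a non-zero pair at `y`
    obtain ⟨rfl, -⟩ := h1
    exact ⟨x, by rwa [Sym2.eq_swap]⟩
  by_cases h2 : z' = z ∧ y ≠ z
  · obtain ⟨rfl, hyz⟩ := h2
    -- the parallel pair `s(y, z)`: `W s(y,z) ⊕ W s(y,x) ≠ 0`
    by_contra hcon
    push Not at hcon
    apply h
    apply Subtype.ext
    rw [coe_cweight_parallel hzx _ hyz hyx, update_mk_z W hzx hyx, update_mk_x W hzx hyz, hcon z', hcon x]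
    simp
  · refine ⟨z', fun h0 => h ?_⟩
    rw [cweight_of_not _ hyx hz'x h1 h2, update_of_not_mem W 1 (fun hm => ?_), h0]
    rcases Sym2.mem_iff.1 hm with hm | hm
    · exact hyx hm.symm
    · exact hz'x hm.symm

/-- Restriction to the blob pairs commutes with switching a blob pair. [folklore] -/
theorem blobRestrict_update {e : Sym2 V} (he : (∃ x' ∈ B, x' ∈ e) ∨ e = s(u, v)) (c : unitInterval) :
    (fun e' => if (∃ x' ∈ B, x' ∈ e') ∨ e' = s(u, v) then Function.update W e c e' else 0) =
      Function.update (fun e' => if (∃ x' ∈ B, x' ∈ e') ∨ e' = s(u, v) then W e' else 0) e c := by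
  funext e'
  by_cases h : e' = e
  · subst h; simp [he]
  · rw [Function.update_of_ne h, Function.update_of_ne h]

include hu hv hx hz hzx hW in
/-- **Restriction to the blob pairs commutes with the contraction of a blob pair.** [this work] -/
theorem blobRestrict_cweight :
    (fun e' => if (∃ x' ∈ B, x' ∈ e') ∨ e' = s(u, v) then cweight z x (Function.update W s(x, z) 1) e' else 0) =
      cweight z x (Function.update
        (fun e' => if (∃ x' ∈ B, x' ∈ e') ∨ e' = s(u, v) then W e' else 0) s(x, z) 1) := by
  -- the restricted weight is again a blob weight with the same update at `e`
  set Wb : Sym2 V → unitInterval := fun e' => if (∃ x' ∈ B, x' ∈ e') ∨ e' = s(u, v) then W e' else 0 with hWb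
  have hWbB : ∀ x' ∈ B, ∀ z', z' ∉ B → z' ≠ u → z' ≠ v → Wb s(x', z') = 0 := by
    intro x' hx' z' hz'B hz'u hz'v
    simp only [hWb]
    split_ifs
    · exact hW x' hx' z' hz'B hz'u hz'v
    · rfl
  have hWb_of : ∀ e', ((∃ x' ∈ B, x' ∈ e') ∨ e' = s(u, v)) → Wb e' = W e' := fun e' he' => by
    simp only [hWb, if_pos he']
  have hWb_not : ∀ e', ¬ ((∃ x' ∈ B, x' ∈ e') ∨ e' = s(u, v)) → Wb e' = 0 := fun e' he' => by
    simp only [hWb, if_neg he']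
  funext e'
  by_cases hxe' : x ∈ e'
  · -- pairs at `x`: both sides `0`
    simp only [cweight_of_mem _ hxe', hWb]
    split_ifs <;> rfl
  revert hxe'
  induction e' using Sym2.ind with
  | h a b =>
    intro hxe'
    have hax : a ≠ x := fun h => hxe' (h ▸ Sym2.mem_mk_left a b)
    have hbx : b ≠ x := fun h => hxe' (h ▸ Sym2.mem_mk_right a b)
    -- parallel case
    have hpar : ∀ a b : V, a ≠ x → b ≠ x → a = z → b ≠ z →
        (if (∃ x' ∈ B, x' ∈ s(a, b)) ∨ s(a, b) = s(u, v) then cweight z x (Function.update W s(x, z) 1) s(a, b)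
          else 0) = cweight z x (Function.update Wb s(x, z) 1) s(a, b) := by
      intro a b hax hbx haz hbz
      subst haz
      by_cases hblob : (∃ x' ∈ B, x' ∈ s(a, b)) ∨ s(a, b) = s(u, v)
      · rw [if_pos hblob, show s(a, b) = s(b, a) from Sym2.eq_swap]
        apply Subtype.ext
        rw [coe_cweight_parallel hzx _ hbz hbx, coe_cweight_parallel hzx _ hbz hbx,
          update_mk_z W hzx hbx, update_mk_x W hzx hbz, update_mk_z Wb hzx hbx, update_mk_x Wb hzx hbz,
          hWb_of s(b, a) (by rwa [Sym2.eq_swap]), hWb_of s(b, x) (Or.inl ⟨x, hx, Sym2.mem_mk_right _ _⟩)]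
      · rw [if_neg hblob, show s(a, b) = s(b, a) from Sym2.eq_swap]
        -- here `a = z ∉ B`, `b ∉ B`, so `z ∈ {u,v}` and `b` is the far side: `W s(x,b) = 0`
        have hbB : b ∉ B := fun h => hblob (Or.inl ⟨b, h, Sym2.mem_mk_right _ _⟩)
        have haB : a ∉ B := fun h => hblob (Or.inl ⟨a, h, Sym2.mem_mk_left _ _⟩)
        have hne : s(a, b) ≠ s(u, v) := fun h => hblob (Or.inr h)
        have hbu : b ≠ u := by
          rintro rfl
          rcases hz with h | h | h
          · exact haB h
          · exact hbz h.symm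
          · exact hne (h ▸ Sym2.eq_swap)
        have hbv : b ≠ v := by
          rintro rfl
          rcases hz with h | h | h
          · exact haB h
          · exact hne (h ▸ rfl)
          · exact hbz h.symm
        symm
        apply Subtype.ext
        rw [coe_cweight_parallel hzx _ hbz hbx, update_mk_z Wb hzx hbx, update_mk_x Wb hzx hbz,
          hWb_not s(b, a) (by rwa [Sym2.eq_swap]), hWb_of s(b, x) (Or.inl ⟨x, hx, Sym2.mem_mk_right _ _⟩),
          show s(b, x) = s(x, b) from Sym2.eq_swap, hW x hx b hbB hbu hbv]
        simp
    by_cases h1 : a = z ∧ b ≠ z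
    · exact hpar a b hax hbx h1.1 h1.2
    by_cases h2 : b = z ∧ a ≠ z
    · have := hpar b a hbx hax h2.1 h2.2
      rw [show s(b, a) = s(a, b) from Sym2.eq_swap] at this
      exact this
    rw [cweight_of_not _ hax hbx h1 h2, cweight_of_not _ hax hbx h1 h2, update_of_not_mem W 1 hxe',
      update_of_not_mem Wb 1 hxe']

end Step


/-! ## One step: probabilities -/

section Probabilities

open MeasureTheory Literature.Combinatorics.Sahi2008
open Literature.Probability.Percolation.DecisionTree (ind ind_of_mem ind_of_not_mem ind_nonneg)
open Literature.Probability.Percolation.BlockExploration (mem_openConn_iff_openConnIn_univ)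

variable [Fintype V]

/-- One-bond decomposition of any event along any pair (the tree's `prodBernoulli_real_oneBond`). [folklore] -/
theorem oneBond (w : Sym2 V → unitInterval) (e : Sym2 V) (A : Set (Set (Sym2 V))) :
    (prodBernoulli w).real A = (1 - (w e : ℝ)) * (prodBernoulli (Function.update w e 0)).real A +
      (w e : ℝ) * (prodBernoulli (Function.update w e 1)).real A :=
  prodBernoulli_real_oneBond (TerminalGluing.determinedBy_coe_univ A) w (Finset.mem_univ e)

omit [Fintype V] in
/-- `{s ↔ t}` is determined by the off-diagonal pairs (loops are never edges of the open graph). [folklore] -/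
theorem determinedBy_openConn_offDiag (s t : V) :
    DeterminedBy (openConn s t : Set (BondConfig V)) {z : Sym2 V | ¬ z.IsDiag} := by
  have hset : (openConn s t : Set (BondConfig V)) = openConnIn Set.univ s t := by
    ext ω; exact mem_openConn_iff_openConnIn_univ
  rw [hset]
  exact (IncStarCutVertex.determinedBy_openConnIn_offDiag (Set.univ : Set V) s t).mono fun z hz => hz.1

omit [Fintype V] in
/-- Principal cluster events are determined by the off-diagonal pairs. [folklore] -/
theorem determinedBy_principal_offDiag (s : V) (U : Finset V) :
    DeterminedBy (⋂ t ∈ U, (openConn s t : Set (BondConfig V))) {z : Sym2 V | ¬ z.IsDiag} := by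
  induction U using Finset.induction_on with
  | empty =>
    have h : (⋂ t ∈ (∅ : Finset V), (openConn s t : Set (BondConfig V))) = Set.univ := by
      ext ω; simp
    rw [h]; exact determinedBy_univ _
  | insert a U ha ih =>
    rw [Finset.set_biInter_insert]
    exact (determinedBy_openConn_offDiag s a).inter ih

/-- Switching a loop does not change the probability of an event determined by the off-diagonal pairs. [folklore] -/
theorem real_update_diag (W : Sym2 V → unitInterval) {e : Sym2 V} (he : e.IsDiag) (c : unitInterval)
    {A : Set (Set (Sym2 V))} (hA : DeterminedBy A {z : Sym2 V | ¬ z.IsDiag}) :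
    (prodBernoulli (Function.update W e c)).real A = (prodBernoulli W).real A :=
  prodBernoulli_real_eq_of_determinedBy _ _ (fun i hi => by
      rw [Function.update_of_ne]
      rintro rfl
      exact hi he) hA MeasurableSet.of_discrete

omit [Fintype V] in
/-- The principal event `{C_s ⊇ U}` corresponds to itself under the contraction of the pair `s(z, x)` when `s` and `U`
avoid `x`. [folklore] -/
theorem principal_contract_iff {z x : V} (hzx : z ≠ x) {s : V} (hs : s ≠ x) {U : Finset V}
    (hU : x ∉ U) (ω : Set (Sym2 V)) (hω : s(z, x) ∈ ω) :
    ω ∈ (⋂ t ∈ U, (openConn s t : Set (BondConfig V))) ↔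
      contract z x ω ∈ (⋂ t ∈ U, (openConn s t : Set (BondConfig V))) := by
  simp only [Set.mem_iInter]
  refine forall₂_congr fun t ht => ?_
  have hts : t ≠ x := fun h => hU (h ▸ ht)
  have key := reachable_contract_iff hzx hω s t
  rw [proj, if_neg hs, proj, if_neg hts] at key
  exact key

omit [Fintype V] in
/-- The two-terminal event `{u ↔ v}` corresponds to itself under the contraction of `s(z, x)`, `x ∉ {u, v}`. [folklore] -/
theorem openConn_contract_iff {z x u v : V} (hzx : z ≠ x) (hux : u ≠ x) (hvx : v ≠ x)
    (ω : Set (Sym2 V)) (hω : s(z, x) ∈ ω) :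
    ω ∈ (openConn u v : Set (BondConfig V)) ↔ contract z x ω ∈ (openConn u v : Set (BondConfig V)) := by
  have key := reachable_contract_iff hzx hω u v
  rw [proj, if_neg hux, proj, if_neg hvx] at key
  exact key

/-- **Open branch = contraction** for principal events avoiding the merged vertex `x`. [folklore] -/
theorem real_principal_contract (W : Sym2 V → unitInterval) {z x s : V} (hzx : z ≠ x) (hsx : s ≠ x)
    {U : Finset V} (hxU : x ∉ U) :
    (prodBernoulli (Function.update W s(x, z) 1)).real (⋂ t ∈ U, (openConn s t : Set (BondConfig V))) =
      (prodBernoulli (cweight z x (Function.update W s(x, z) 1))).real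
        (⋂ t ∈ U, (openConn s t : Set (BondConfig V))) := by
  refine real_eq_of_contract hzx _ ?_ _ _ fun ω hω => principal_contract_iff hzx hsx hxU ω hω
  rw [show s(z, x) = s(x, z) from Sym2.eq_swap, Function.update_self]

/-- **One step for the two-terminal probability of the blob restriction**: one-bond decomposition along a blob
pair `e = s(x,z)` and contraction of the open branch. [this work] -/
theorem blob_real_openConn_step {B : Finset V} {u v x z : V} (W : Sym2 V → unitInterval)
    (hu : u ∉ B) (hv : v ∉ B) (hx : x ∈ B) (hz : z ∈ B ∨ z = u ∨ z = v) (hzx : z ≠ x)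
    (hW : ∀ x' ∈ B, ∀ z', z' ∉ B → z' ≠ u → z' ≠ v → W s(x', z') = 0) :
    (prodBernoulli (fun e' => if (∃ x' ∈ B, x' ∈ e') ∨ e' = s(u, v) then W e' else 0)).real (openConn u v) =
      (1 - (W s(x, z) : ℝ)) *
          (prodBernoulli (fun e' => if (∃ x' ∈ B, x' ∈ e') ∨ e' = s(u, v) then
            Function.update W s(x, z) 0 e' else 0)).real (openConn u v) +
        (W s(x, z) : ℝ) *
          (prodBernoulli (fun e' => if (∃ x' ∈ B, x' ∈ e') ∨ e' = s(u, v) then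
            cweight z x (Function.update W s(x, z) 1) e' else 0)).real (openConn u v) := by
  have hux : u ≠ x := fun h => hu (h ▸ hx)
  have hvx : v ≠ x := fun h => hv (h ▸ hx)
  have hblob_e : (∃ x' ∈ B, x' ∈ s(x, z)) ∨ s(x, z) = s(u, v) := Or.inl ⟨x, hx, Sym2.mem_mk_left x z⟩
  have hopen : (prodBernoulli (Function.update
      (fun e' => if (∃ x' ∈ B, x' ∈ e') ∨ e' = s(u, v) then W e' else 0) s(x, z) 1)).real (openConn u v) =
      (prodBernoulli (fun e' => if (∃ x' ∈ B, x' ∈ e') ∨ e' = s(u, v) then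
        cweight z x (Function.update W s(x, z) 1) e' else 0)).real (openConn u v) := by
    rw [blobRestrict_cweight W hu hv hx hz hzx hW]
    refine real_eq_of_contract hzx _ ?_ _ _ fun ω hω => openConn_contract_iff hzx hux hvx ω hω
    rw [show s(z, x) = s(x, z) from Sym2.eq_swap, Function.update_self]
  rw [oneBond _ s(x, z) (openConn u v), hopen, ← blobRestrict_update W hblob_e 0]
  simp only [if_pos hblob_e]

end Probabilities

end SahiBlobReduction

end Summit.CriticalPhenomena.PercolationContinuityZ3.Theorems
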